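import Mathlib
import Summits.Ventures.PercRepro.TriangleCapFourPieces
import Summits.Ventures.PercRepro.TriangleCapFourCap
import Summits.Ventures.PercRepro.TriangleCapBelowBig
import Summits.Ventures.PercRepro.TriangleCapFourRowFourTMain
import Summits.Ventures.PercRepro.TriangleCapFourRowThree
import Summits.Ventures.PercRepro.TriangleCapFourRowTwo

/-!
# PercRepro — THE ROW `a = 4` AT EVERY `r = 4 + j`, `k ≥ 12 + j`: on the cell `(k, 4, 4 + j)` every `K₄⁻`-free graph
that is not `4`-bipartite is at least `2k − 14 + 2j` below the closed form — the one-triangle gap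
(p3, gen 49; part 205e)

The induction of part 203f at `a = 4`: the cap `cap_four_regime` (part 205b, `K ≥ 9 + j`), the window, the deletions
of a vertex `z` of degree `d ≤ 3` onto `(k − 1, 4, d + j)` — a `B2` cell of the row `4` (part 204b), the cell
`(k − 1, 4, 2)` (part 197, gap `2 (k − 10)`), the cell `(k − 1, 4, 3)` (part 199, gap `2 (k − 1) − 18`), the row
`r′ = 4 + j′` (the induction hypothesis; `j′ = 0` is the cell `(k, 4, 4)` of part 199q, the base) — and the mixed
reads of part 203c/203d, which carry no bound on `a`. The corner `k = 12 + j` is included (part 205b). Axioms: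
standard.
-/

namespace PercRepro

namespace TriangleCap

namespace C047

open Finset

universe u

/-- **THE ROW `a = 4` AT `r = 4 + j`** (the induction form): for every `j`, every finite `K₄⁻`-free graph on
`k ≥ 12 + j` vertices with `4 (k − 4) − (4 + j)` edges is `4`-bipartite or at least `2k − 14 + 2j` below the closed
form. -/
theorem rowFour_second_order_aux (j : ℕ) :
    ∀ (W : Type u) [Fintype W] [DecidableEq W] (D : SimpleGraph W) [DecidableRel D.Adj], K4mFree D →
      12 + j ≤ Fintype.card W → D.edgeFinset.card + (4 + j) = 4 * (Fintype.card W - 4) →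
        (∃ A : Finset W, A.card = 4 ∧ BipSub D A) ∨
          ∑ v, deg D v * deg D v + (4 + j) * (Fintype.card W - 1 - (4 + j)) +
              (2 * Fintype.card W - 14 + 2 * j * (4 - 3)) ≤ D.edgeFinset.card * Fintype.card W := by
  induction j using Nat.strong_induction_on with
  | _ j ih =>
  intro W _ _ D _ hK hk hm
  rcases Nat.eq_zero_or_pos j with hj0 | hj1
  · -- `j = 0`: the cell `(k, 4, 4)` (part 199q)
    subst hj0
    have hm0 : D.edgeFinset.card + 4 = 4 * (Fintype.card W - 4) := by simpa using hm
    rcases four_four_second_order_T D hK (by omega) hm0 with h | h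
    · exact Or.inl h
    · right
      have e2 : 2 * Fintype.card W - 14 + 2 * 0 * (4 - 3) = 2 * Fintype.card W - 14 := by omega
      have e1 : (4 + 0) * (Fintype.card W - 1 - (4 + 0)) = 4 * (Fintype.card W - 5) := by
        have e : Fintype.card W - 1 - (4 + 0) = Fintype.card W - 5 := by omega
        rw [e]
      rw [e2, e1]
      exact h
  · -- `j ≥ 1`
    have hk2 : 2 * 4 + 2 ≤ Fintype.card W := by omega
    -- (A) 4 vertex at the cap
    by_cases hx : ∃ x, deg D x + 4 = Fintype.card W
    · obtain ⟨x, hx⟩ := hx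
      exact cap_four_regime D hK j hk hm x hx
    push Not at hx
    have hcap : ∀ v, deg D v + 4 ≤ Fintype.card W := fun v =>
      deg_add_le_card_of_dense D hK 4 (by omega) (by omega)
        (cap_arith 4 (Fintype.card W) D.edgeFinset.card (4 + j) (by omega) (by omega)
          (below_cap_arith 4 (Fintype.card W) D.edgeFinset.card (4 + j) (by omega) hm)) v
    have hcap' : ∀ v, deg D v + 4 + 1 ≤ Fintype.card W := fun v => by
      have h1 := hcap v
      have h2 := hx v
      omega
    have hcap2 : ∀ v, deg D v ≤ (Fintype.card W - 4 - 2) + 1 := fun v => by have := hcap' v; omega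
    -- (B) every degree `≥ 4`: the window
    by_cases hdeg : ∀ v, 4 ≤ deg D v
    · exact Or.inr (rowFour_window D j hk hm hcap' hdeg)
    push Not at hdeg
    obtain ⟨z, hz⟩ := hdeg
    -- (C) the deletion bookkeeping: `D − z` on `(k − 1, 4, d + j)`
    have hK' := k4mFree_del D hK z
    have hcard' := card_del z
    have hedges' := card_edges_del D z
    have hsq := sum_deg_sq_del D z
    have hT := sum_del_nbhd_le D z (Fintype.card W - 4 - 2) hcap2
    obtain ⟨T, hTdef⟩ : ∃ T, ∑ w : {v : W // v ≠ z}, (if D.Adj w.1 z then deg (del D z) w else 0) = T := ⟨_, rfl⟩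
    obtain ⟨S', hS'def⟩ : ∃ S', ∑ w : {v : W // v ≠ z}, deg (del D z) w * deg (del D z) w = S' := ⟨_, rfl⟩
    obtain ⟨m', hm'def⟩ : ∃ m', (del D z).edgeFinset.card = m' := ⟨_, rfl⟩
    rw [hTdef, hS'def] at hsq
    rw [hTdef] at hT
    rw [hm'def] at hedges'
    have hcardV' : Fintype.card {v : W // v ≠ z} = Fintype.card W - 1 := by omega
    have hm' : (del D z).edgeFinset.card + (deg D z + j) = 4 * (Fintype.card {v : W // v ≠ z} - 4) := by
      rw [hm'def, hcardV']
      exact below_cell_edges 4 (4 + j) (deg D z + j) (deg D z) (Fintype.card W) D.edgeFinset.card m' hk2 (by omega)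
        hedges' hm
    have hmd : m' + deg D z + (4 + j) = 4 * (Fintype.card W - 4) := by omega
    have hfin : S' + 2 * T + deg D z + deg D z * deg D z + (4 + j) * (Fintype.card W - 1 - (4 + j)) +
          (2 * Fintype.card W - 14 + 2 * j * (4 - 3)) ≤ (m' + deg D z) * Fintype.card W →
        ∑ v, deg D v * deg D v + (4 + j) * (Fintype.card W - 1 - (4 + j)) +
            (2 * Fintype.card W - 14 + 2 * j * (4 - 3)) ≤ D.edgeFinset.card * Fintype.card W := by
      intro h
      rw [hsq, ← hedges']
      exact h
    -- the `4`-bipartite alternative of `D − z`: the mixed reads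
    have hbip : ∀ A' : Finset {v : W // v ≠ z}, A'.card = 4 → BipSub (del D z) A' →
        (∃ A : Finset W, A.card = 4 ∧ BipSub D A) ∨
          (∑ v, deg D v * deg D v + (4 + j) * (Fintype.card W - 1 - (4 + j)) +
              (2 * Fintype.card W - 14 + 2 * j * (4 - 3)) ≤ D.edgeFinset.card * Fintype.card W) := by
      intro A' hA'card hB
      rcases sides_four_gen D j hk hm z (by omega) A' hA'card hB hm' hcap2 with h | h |
        ⟨hd2, ⟨w₀, hw₀A, hw₀z⟩, ⟨w₁, hw₁A, hw₁z⟩, hTcrude⟩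
      · exact Or.inl h
      · exact Or.inr h
      · right
        apply hfin
        rw [hTdef] at hTcrude
        rcases Nat.lt_or_ge (deg D z) 3 with hd3 | hd3
        · -- `d = 2`: the crude read
          have hd : deg D z = 2 := by omega
          have hS := sum_deg_sq_le_of_bipSub (del D z) A' hB 4 (deg D z + j) hA'card hm' (by omega)
          rw [hS'def, hm'def, hcardV'] at hS
          rw [hd] at hS hTcrude hmd ⊢
          have hTc : T ≤ (Fintype.card W - 4 - 2) + 4 := by omega
          exact rowT_mixed_two_four j (Fintype.card W) m' S' T hk hmd hS hTc
        · -- `d ≥ 3`: the vertex bound at `w₀`, with the leaf read at `x = t − 1`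
          obtain ⟨t, s₀, x, hts, ht1, hs₀1, htx, hxr, hxa, hS, hT1, hT2, hleaf⟩ :=
            mixed_vertex_core_T D hK 4 (by omega) z A' hA'card hB (deg D z + j) (by omega) hm' hcap2 w₀ hw₀A hw₀z
              w₁ hw₁A hw₁z
          rw [hS'def, hm'def, hcardV'] at hS hleaf
          rw [hTdef] at hT1 hT2 hleaf
          have hda : deg D z + 1 ≤ 4 := by omega
          rcases Nat.lt_or_ge x t with hxt | hxt
          · -- `x = t − 1`: the leaf read
            have hxt' : x + 1 = t := by omega
            have hL := hleaf hxt'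
            rcases Nat.lt_or_ge s₀ 2 with hs₀ | hs₀
            · have hs₀' : s₀ = 1 := by omega
              have ht : t = deg D z - 1 := by omega
              rw [hs₀', ht] at hL
              simp only [Nat.sub_self, zero_mul, mul_zero, add_zero] at hL
              exact rowT_one_lo 4 j (deg D z) x (Fintype.card W) m' S' T (by omega) hd3 hda (by omega) hmd hL
            · exact rowT_two_lo 4 j (deg D z) t s₀ x (Fintype.card W) m' S' T (by omega) hd3 hda hts ht1 hs₀ hxt' hmd hL
          · -- `x ≥ t`: the plain read at the endpoints `x = t` and `x = min (d + j, 4)`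
            have hC1 : S' + 2 * T + (deg D z + j) * (Fintype.card W - 1 - 1 - (deg D z + j)) +
                (2 * ((deg D z + j - x) * (x - 1)) + 2 * x) ≤
                m' * (Fintype.card W - 1) + 2 * (t * (Fintype.card W - 4 - 2)) + 2 * 4 +
                  2 * ((s₀ - 1) * (4 + 1 - t)) := by omega
            have hC2 : S' + 2 * T + (deg D z + j) * (Fintype.card W - 1 - 1 - (deg D z + j)) +
                (2 * ((deg D z + j - x) * (x - 1)) + 2 * x) ≤
                m' * (Fintype.card W - 1) + 2 * (t * (Fintype.card W - 4 - s₀)) + 2 * 4 +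
                  2 * ((s₀ - 1) * (4 + 1 - t)) := by omega
            by_cases hsa : deg D z + j ≤ 4
            · rcases concave_endpoint' (deg D z + j) t (deg D z + j) x hxt hxr (le_refl _) with hg | hg
              · rcases Nat.lt_or_ge s₀ 2 with hs₀ | hs₀
                · have hs₀' : s₀ = 1 := by omega
                  have hST : S' + 2 * T + (deg D z + j) * (Fintype.card W - 1 - 1 - (deg D z + j)) +
                      (2 * ((deg D z + j - t) * (t - 1)) + 2 * t) ≤
                      m' * (Fintype.card W - 1) + 2 * ((deg D z - 1) * (Fintype.card W - 4 - 2)) + 2 * 4 := by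
                    rw [hs₀'] at hC1
                    have ht : t = deg D z - 1 := by omega
                    rw [ht] at hC1 hg ⊢
                    simp only [Nat.sub_self, zero_mul, mul_zero, add_zero] at hC1
                    omega
                  exact rowT_one_t 4 j (deg D z) t (Fintype.card W) m' S' T (by omega) hd3 hda (by omega) hmd hST
                · have hST : S' + 2 * T + (deg D z + j) * (Fintype.card W - 1 - 1 - (deg D z + j)) +
                      (2 * ((deg D z + j - t) * (t - 1)) + 2 * t) ≤
                      m' * (Fintype.card W - 1) + 2 * (t * (Fintype.card W - 4 - s₀)) + 2 * 4 +
                        2 * ((s₀ - 1) * (4 + 1 - t)) := by omega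
                  exact rowT_two_t 4 j (deg D z) t s₀ t (Fintype.card W) m' S' T (by omega) hd3 hda hts ht1 hs₀ rfl hmd hST
              · rcases Nat.lt_or_ge s₀ 2 with hs₀ | hs₀
                · have hs₀' : s₀ = 1 := by omega
                  have hST : S' + 2 * T + (deg D z + j) * (Fintype.card W - 1 - 1 - (deg D z + j)) +
                      (2 * ((deg D z + j - (deg D z + j)) * (deg D z + j - 1)) + 2 * (deg D z + j)) ≤
                      m' * (Fintype.card W - 1) + 2 * ((deg D z - 1) * (Fintype.card W - 4 - 2)) + 2 * 4 := by
                    rw [hs₀'] at hC1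
                    have ht : t = deg D z - 1 := by omega
                    rw [ht] at hC1
                    simp only [Nat.sub_self, zero_mul, mul_zero, add_zero] at hC1
                    omega
                  exact rowT_one_hi_s 4 j (deg D z) (deg D z + j) (Fintype.card W) m' S' T (by omega) (by omega) hd3 hda hsa rfl
                    hmd hST
                · have hST : S' + 2 * T + (deg D z + j) * (Fintype.card W - 1 - 1 - (deg D z + j)) +
                      (2 * ((deg D z + j - (deg D z + j)) * (deg D z + j - 1)) + 2 * (deg D z + j)) ≤
                      m' * (Fintype.card W - 1) + 2 * (t * (Fintype.card W - 4 - s₀)) + 2 * 4 +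
                        2 * ((s₀ - 1) * (4 + 1 - t)) := by omega
                  exact rowT_two_hi_s 4 j (deg D z) t s₀ (deg D z + j) (Fintype.card W) m' S' T (by omega) hd3 hda hts
                    ht1 hs₀ hsa rfl hmd hST
            · push Not at hsa
              rcases concave_endpoint' (deg D z + j) t 4 x hxt hxa (by omega) with hg | hg
              · rcases Nat.lt_or_ge s₀ 2 with hs₀ | hs₀
                · have hs₀' : s₀ = 1 := by omega
                  have hST : S' + 2 * T + (deg D z + j) * (Fintype.card W - 1 - 1 - (deg D z + j)) +
                      (2 * ((deg D z + j - t) * (t - 1)) + 2 * t) ≤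
                      m' * (Fintype.card W - 1) + 2 * ((deg D z - 1) * (Fintype.card W - 4 - 2)) + 2 * 4 := by
                    rw [hs₀'] at hC1
                    have ht : t = deg D z - 1 := by omega
                    rw [ht] at hC1 hg ⊢
                    simp only [Nat.sub_self, zero_mul, mul_zero, add_zero] at hC1
                    omega
                  exact rowT_one_t 4 j (deg D z) t (Fintype.card W) m' S' T (by omega) hd3 hda (by omega) hmd hST
                · have hST : S' + 2 * T + (deg D z + j) * (Fintype.card W - 1 - 1 - (deg D z + j)) +
                      (2 * ((deg D z + j - t) * (t - 1)) + 2 * t) ≤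
                      m' * (Fintype.card W - 1) + 2 * (t * (Fintype.card W - 4 - s₀)) + 2 * 4 +
                        2 * ((s₀ - 1) * (4 + 1 - t)) := by omega
                  exact rowT_two_t 4 j (deg D z) t s₀ t (Fintype.card W) m' S' T (by omega) hd3 hda hts ht1 hs₀ rfl hmd hST
              · rcases Nat.lt_or_ge s₀ 2 with hs₀ | hs₀
                · have hs₀' : s₀ = 1 := by omega
                  have hST : S' + 2 * T + (deg D z + j) * (Fintype.card W - 1 - 1 - (deg D z + j)) +
                      (2 * ((deg D z + j - 4) * (4 - 1)) + 2 * 4) ≤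
                      m' * (Fintype.card W - 1) + 2 * ((deg D z - 1) * (Fintype.card W - 4 - 2)) + 2 * 4 := by
                    rw [hs₀'] at hC1
                    have ht : t = deg D z - 1 := by omega
                    rw [ht] at hC1
                    simp only [Nat.sub_self, zero_mul, mul_zero, add_zero] at hC1
                    omega
                  exact rowT_one_hi_a 4 j (deg D z) 4 (Fintype.card W) m' S' T (by omega) (by omega) hd3 hda (by omega) rfl hmd
                    hST
                · have hST : S' + 2 * T + (deg D z + j) * (Fintype.card W - 1 - 1 - (deg D z + j)) +
                      (2 * ((deg D z + j - 4) * (4 - 1)) + 2 * 4) ≤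
                      m' * (Fintype.card W - 1) + 2 * (t * (Fintype.card W - 4 - s₀)) + 2 * 4 +
                        2 * ((s₀ - 1) * (4 + 1 - t)) := by omega
                  exact rowT_two_hi_a 4 j (deg D z) t s₀ 4 (Fintype.card W) m' S' T (by omega) hd3 hda hts ht1 hs₀
                    (by omega) rfl hmd hST
    -- (D) the cell of `D − z`
    rcases Nat.lt_or_ge (deg D z + j + 2) 4 with hs3 | hs3
    · -- `d + j ≤ 1`: a `B2` cell of the row `4`
      rcases below_second_order_every (del D z) hK' 4 (deg D z + j) (by omega) (by omega) (by omega) hm'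
        with ⟨A', hA'card, hB⟩ | hgap
      · exact hbip A' hA'card hB
      · right
        apply hfin
        rw [hS'def, hm'def, hcardV'] at hgap
        exact rowT_del_B2 4 j (deg D z) (Fintype.card W) m' S' T (by omega) (by omega) hmd hgap hT
    · rcases Nat.lt_or_ge (deg D z + j + 1) 4 with hs2 | hs2
      · -- `d + j = 2`: the cell `(k − 1, 4, 2)` (part 197)
        have hs : deg D z + j = 2 := by omega
        have hm'' : (del D z).edgeFinset.card + 2 = 4 * (Fintype.card {v : W // v ≠ z} - 4) := by
          rw [← hs]; exact hm'
        rcases four_two_second_order (del D z) hK' (by omega) hm'' with ⟨A', hA'card, hB⟩ | hgap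
        · exact hbip A' hA'card hB
        · right
          apply hfin
          rw [hS'def, hm'def, hcardV'] at hgap
          have hgap' : S' + (4 - 2) * (Fintype.card W - 1 - 1 - (4 - 2)) + 2 * (Fintype.card W - 1 - 2 * 4 - 1) ≤
              m' * (Fintype.card W - 1) := by
            have e1 : (4 - 2) * (Fintype.card W - 1 - 1 - (4 - 2)) = 2 * (Fintype.card W - 1 - 3) := by omega
            have e2 : Fintype.card W - 1 - 2 * 4 - 1 = Fintype.card W - 1 - 9 := by omega
            rw [e1, e2]
            exact hgap
          exact rowT_del_T_four j (deg D z) (Fintype.card W) m' S' T (by omega) hk hmd hgap' hT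
      · rcases Nat.lt_or_ge (deg D z + j) 4 with hs1 | hs1
        · -- `d + j = 3`: the cell `(k − 1, 4, 3)` (part 199)
          have hs : deg D z + j = 3 := by omega
          have hm'' : (del D z).edgeFinset.card + 3 = 4 * (Fintype.card {v : W // v ≠ z} - 4) := by
            rw [← hs]; exact hm'
          rcases four_three_second_order (del D z) hK' (by omega) hm'' with ⟨A', hA'card, hB⟩ | hgap
          · exact hbip A' hA'card hB
          · right
            apply hfin
            rw [hS'def, hm'def, hcardV'] at hgap
            have hgap' : S' + (4 - 1) * (Fintype.card W - 1 - 1 - (4 - 1)) + 2 * (Fintype.card W - 1 - 2 * 4 - 1) ≤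
                m' * (Fintype.card W - 1) := by
              have e1 : (4 - 1) * (Fintype.card W - 1 - 1 - (4 - 1)) = 3 * (Fintype.card W - 1 - 4) := by omega
              have e2 : 2 * (Fintype.card W - 1 - 2 * 4 - 1) = 2 * (Fintype.card W - 1) - 18 := by omega
              rw [e1, e2]
              exact hgap
            exact rowT_del_B_four j (deg D z) (Fintype.card W) m' S' T (by omega) hk hmd hgap' hT
        · -- `d + j = 4 + j′`, `j′ ≤ j − 1`: the induction hypothesis
          obtain ⟨j', hj'⟩ : ∃ j', deg D z + j = 4 + j' := ⟨deg D z + j - 4, by omega⟩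
          have hj'lt : j' < j := by omega
          have hm'' : (del D z).edgeFinset.card + (4 + j') = 4 * (Fintype.card {v : W // v ≠ z} - 4) := by
            rw [← hj']; exact hm'
          rcases ih j' hj'lt {v : W // v ≠ z} (del D z) hK' (by omega) hm'' with ⟨A', hA'card, hB⟩ | hgap
          · exact hbip A' hA'card hB
          · right
            apply hfin
            rw [hS'def, hm'def, hcardV'] at hgap
            exact rowT_del_up_T_four j (deg D z) j' (Fintype.card W) m' S' T hj' (by omega) hk hmd hgap hT

/-- **THE ROW `a = 4` AT `r = 4 + j`, `k ≥ 12 + j`:** `K₄⁻`-free, `m + (4 + j) = 4 (k − 4)` ⇒ `4`-bipartite or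
`Σ_v d(v)² + (4 + j)(k − 1 − (4 + j)) + (2k − 14 + 2j) ≤ m k` — the one-triangle gap. -/
theorem rowFour_second_order {V : Type*} [Fintype V] [DecidableEq V] (D : SimpleGraph V) [DecidableRel D.Adj]
    (hK : K4mFree D) (j : ℕ) (hk : 12 + j ≤ Fintype.card V)
    (hm : D.edgeFinset.card + (4 + j) = 4 * (Fintype.card V - 4)) :
    (∃ A : Finset V, A.card = 4 ∧ BipSub D A) ∨
      ∑ v, deg D v * deg D v + (4 + j) * (Fintype.card V - 1 - (4 + j)) +
          (2 * Fintype.card V - 14 + 2 * j * (4 - 3)) ≤ D.edgeFinset.card * Fintype.card V :=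
  rowFour_second_order_aux j V D hK hk hm

/-- **THE NON-BIPARTITE SECOND-BEST VALUE ON THE CELL `(k, 4, 4 + j)`, `k ≥ 12 + j`:** EXACTLY
`m k − (4 + j)(k − 5 − j) − (2k − 14 + 2j)`, attained by the one-triangle family `tFamilyGen (k − 1) 4 (j + 2)`. -/
theorem rowFour_nonbip_second_best (k j : ℕ) (hk : 12 + j ≤ k) :
    (∀ (D : SimpleGraph (Fin k)) [DecidableRel D.Adj], K4mFree D → D.edgeFinset.card + (4 + j) = 4 * (k - 4) →
        (¬ ∃ A : Finset (Fin k), A.card = 4 ∧ BipSub D A) →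
        ∑ v, deg D v * deg D v + (4 + j) * (k - 1 - (4 + j)) + (2 * k - 14 + 2 * j * (4 - 3)) ≤
          D.edgeFinset.card * k) ∧
      ∃ (D : SimpleGraph (Fin k)) (_ : DecidableRel D.Adj), K4mFree D ∧ D.edgeFinset.card + (4 + j) = 4 * (k - 4) ∧
        (¬ ∃ A : Finset (Fin k), A.card = 4 ∧ BipSub D A) ∧
        ∑ v, deg D v * deg D v + (4 + j) * (k - 1 - (4 + j)) + (2 * k - 14 + 2 * j * (4 - 3)) =
          D.edgeFinset.card * k := by
  have hcard : Fintype.card (Fin k) = k := Fintype.card_fin k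
  refine ⟨?_, ?_⟩
  · intro D _ hK hm hnb
    rcases rowFour_second_order D hK j (by rw [hcard]; exact hk) (by rw [hcard]; exact hm) with h | h
    · exact absurd h hnb
    · rw [hcard] at h
      exact h
  · obtain ⟨n, rfl⟩ : ∃ n, k = n + 1 := ⟨k - 1, by omega⟩
    obtain ⟨hK, hE, hS, hnb⟩ := tFamilyGen_value n 4 (j + 2) (by omega) (by omega) (by omega)
    refine ⟨tFamilyGen n 4 (j + 2) (by omega), inferInstance, hK, ?_, fun ⟨A, _, hB⟩ => hnb A hB, ?_⟩
    · have e : j + 2 + 4 - 2 = 4 + j := by omega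
      rw [e] at hE
      exact hE
    · have e : j + 2 + 4 - 2 = 4 + j := by omega
      rw [e] at hS
      have e2 : 2 * (n - 2 * 4) + 2 * (j + 2) * (4 - 3) = 2 * (n + 1) - 14 + 2 * j * (4 - 3) := by omega
      rw [add_assoc, e2] at hS
      exact hS

end C047

end TriangleCap

end PercRepro
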